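import Literature.MathematicalPhysics.QuantumFieldTheory.Balaban1983to89.NodeOLettersSqrtExpDecay

/-!
# `Balaban1983to89.NodeOLettersOfWalks` — NODE O's letters (L1)–(L3) FROM JOINT WALK EXPANSIONS OF THE PRIMITIVE KERNELS
# ([Balaban1985BackgroundPropagators] Thm 3.10 shape), and the `TermLetters` of a (2.14)-term of [Balaban1988RG2Cluster] whose
# Γ-kernel is «local factor × square root» from SUCH DATA ONLY (the t2∕t3 recipe of the N10 -b hand-over in the in-edge's currency)

statement-level bookkeeping over published theorems with citation tags; kernel-checked compositions of tree theorems; nothing here is a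
claim about the Yang–Mills mass gap.

Cell `pub-ymgap`, D-0062 Track A, node N10 = [Balaban1988RG2Cluster] Lemmas 1–3; seat `dag-n10-b` g3 (-b FIRST-MISSING-ESTIMATE), the
REGULAR successor module named at g2's close (trigger t3 = the landing of `NodeOLettersSqrtExpDecay`, p430720); v1.1 (g4) = §6;
v1.2∕v1.3 (g5) = DOCSTRINGS ONLY (this header's §6 ∕ CHAIN lines and one clause at `termLetters_of_walks₂`, answering the cell's
discharge referee READ-330 (i)(ii) and pointing at the downstream leaf `NodeOLettersOfWalksAcross`; every declaration byte-identical
to v1.1).  WHY.  NODE O's walk-free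
interface (`NodeOLetters.termWalkData_of_letters`) consumes `TermLetters` of a (2.14)-term; the -b recipe `NodeOLettersSqrtAlmostLocal.
termLetters_of_sqrtFactor` (p428592) produces them from letters of the LOCAL factor `L = C*Δ_k(σ)C_{Z₀ᶜ}`, of the term's precision `A2`
and — for the square root `(C^{(k)})^{1/2}(σ)` of (2.7) — from ALMOST-LOCAL hypotheses on the full precision `P = C*Δ_k(σ)C`
(`(e^{κd₁} − 1)`-weighted off-diagonal sums `≤ ϱ ≤ m/2` at some rate `κ`), with the σ-localisation of `P` through `X` in the
inf-convolution distance `d_X` as a further hypothesis.  Print supplies NONE of these three shapes directly: what [13] = [B9] delivers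
for the operators determining `Δ_k` and for `C^{(k)}(Z₀)` (p. 13: *"This construction was discussed in [13] for all operators determining
Δ_k, and for C^{(k)}(Z₀), but not for (C^{(k)})^{1/2}"*) is a GENERALIZED RANDOM WALK EXPANSION — in the tree's vocabulary a
`B13JointWalkExpansion.JointWalkExpansion` (Thm 3.10 p. 416: convergent expansion, per-term bounds (3.108), summability (3.154), termwise
analyticity in the background, σ carried only by walks THROUGH the far cubes, p. 13).  This file closes that currency gap BY NAME:
* §1 `sub_ref_entry_le_passDist`, `sigmaLoc_of_sigmaThroughWalks` — the σ-difference of a kernel with `SigmaThroughWalks` data is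
  bounded in the INF-CONVOLUTION distance through `X` (`B9SectDWalk.passDist` = `NodeOLetters.distX`, `distX_eq_passDist`):
  `‖(K(σ) − K(0))(i,j)‖ ≤ 2K̄₀·e^{−κd₁(loc i, loc j)}·e^{−ε·d_X(loc i, loc j)}` — the letter (L2) shape (the tree's
  `B13SigmaThroughWalks.sub_ref_entry_le` keeps only the uniform far-ness gain `e^{−εR}`; the `d_X` form is `B9SectDWalkThrough.
  subfamily_through_sum_le`, [B9] (3.154));
* §2 `kernelLetters_of_jointWalkExpansion` — THE CONVERSE of `NodeOLetters.jointWalkExpansion_of_letters`: a `JointWalkExpansion` of a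
  kernel family through `X` on the `R`-ball with drop `ε ≥ 0`, torus rate `κ ≥ 0` and constant `K̄` yields `KernelLetters` at every rate
  `ρ₀ ≤ min(κ, ε)` with constants `(K̄, 2K̄)` (decay ← `JointWalkExpansion.majorants`; σ-localisation ← §1; holomorphy ←
  `JointWalkExpansion.analyticOnBall`, i.e. `B13ExpansionAnalytic`);
* §3 `termLetters_of_sqrtFactor_expDecay` — the t2-recipe with the square root's precision letters in EXPONENTIAL-DECAY currency
  (`NodeOLettersSqrtExpDecay.kernelLetters_invSqrt_of_expDecay`, ym-nodeO P2's k-uniform rate recipe) and the covariance letter of `A2`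
  from ITS decay letter (`weightedSums_le_half_of_expDecay` + `B13Sqrt27AccretiveAlmostLocal.almostLocal_inverse_decay`): no
  weighted-sum hypothesis (`hProw ∕ hPcol ∕ hArow ∕ hAcol`, `ϱ`, `ϱ_A`) is left — one volume constant `c_V` at one rate `η` serves all;
* §4 **`termLetters_of_walks`** — THE CAPSTONE: `TermLetters` of the term from three `JointWalkExpansion`s (local factor `L`, full
  precision `P`, term precision `A2`) + accretivity of `P` and `A2` at complex background (the p. 15 *"perturbative argument"*, in the
  tree `B13Sqrt27AccretiveSquare.accretive_of_isSymm_re_coercive`) + the product reading `G2 = L·P^{−1/2}` + volume sums + far-ness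
  + rate bookkeeping; every constant of the output is an explicit function of the inputs' constants;
* §5 `exists_rates` — the rate bookkeeping of §3∕§4 is jointly satisfiable with STRICTLY POSITIVE output rates for any positive input
  rates (elementary; non-vacuity of the side conditions, not of the objects).
* §6 (v1.1) `termLetters_of_sqrtFactor_expDecay₂`, **`termLetters_of_walks₂`** — the TWO-CONSTANT EDITIONS of §3∕§4: the square
  root's Combes–Thomas condition reads its OWN volume constant `c_V₀` at rate `κ_P∕2` (`hvolN₀`, `hκm : 8K̄_Pκc_V₀ ≤ mκ_P`), the
  four rate-`η` volume sums read `c_V`, `η ≤ κ_P∕2` dropped; outputs verbatim.  Repairs the slot guard LOCATED by the memo cell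
  `ym-nodeO-ideate` P3 g24 on §4 as typed (one `c_V` at one rate `η` in both places forces `16K̄_Pηc_V(η) ≤ mκ_P`, instantiable
  only by precisions decaying at a large torus rate with an unchanged constant); §3∕§4 are the specialisation `c_V₀ := c_V`.
  **THE (B1) PER-TERM INPUT OF RECORD IS `termLetters_of_walks₂`** (its hypothesis list = what a witness ∕ a uniform package
  targets; inhabited non-degenerately and volume-uniformly by the models of `NodeOLettersOfWalksWitness`, p439809).
CHAIN (by name, unchanged downstream): §6 `termLetters_of_walks₂` (or its specialisation §4) ⟹ `NodeOLetters.termWalkData_of_letters`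
⟹ `B13TermWalkData.localisation17a_of_termWalkData` ∕ `differences216_of_termWalkData` ⟹ L17a ∧ L16a ⟹
`B13PrimitiveKernels216.h226_torus_of_kernelBounds` ⟹ (2.26) ⟹ (2.38); across a family of terms ∕ tori the per-term letters feed
`NodeOLetters.acrossSmall_of_letters` ⟹ `B13TermWalkDataOneTorus.ExistsUniformAcrossSmall` (NODE O's binder) — packaged
ACROSS a family as `NodeOLettersOfWalksAcross.acrossSmall_of_walks` (`UniformWalksAcross 𝓣 q` ⟹ `ExistsUniformAcrossSmall 𝓣 α R_σ0 θ₀`).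

CITATIONS.  [Balaban1988RG2Cluster] p. 13 (σ₀-cubes, *"dist(X, Z₀) > ⅔M"*, the square root of (2.7), *"G̃₃(x) has the same properties
as G̃₂"*), p. 15 (*"The general case is handled by a perturbative argument"*), (2.16) p. 16; [Balaban1985BackgroundPropagators] (3.93)
p. 410, Thm 3.10 ∕ (3.108) p. 416, (3.154) p. 427.  Held text `paper:balaban1988-cmp116-rg-ii-cluster` pp. 12–17 re-read this session.

HONEST FRAMING: finite-matrix bookkeeping joining tree interfaces by name; NOTHING of Bałaban's operators is constructed; whether HIS
`C*Δ_k(σ,𝐔,𝐉)C`, `C*Δ_k(σ)C_{Z₀ᶜ}`, `Δ^{(k)}(Z₀,σ)` admit joint walk expansions with k-uniform constants at complex backgrounds is the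
OBJECT-level content of [13] ∕ cell GAPS G-B9-10 ∕ in-edge N06 and of the NODE 00 pin — hypotheses here; count-neutral Track-A side
landing; NOT a discharge of N10; NOT NODE O; nothing continuum ∕ ℝ⁴ ∕ OS ∕ mass-gap ∕ Clay.  0 `sorry`, 0 `def`, standard axioms.
-/

noncomputable section

namespace Literature.MathematicalPhysics.QuantumFieldTheory.Balaban1983to89.NodeOLettersOfWalks

open Metric Set Finset
open scoped Matrix
open Literature.MathematicalPhysics.QuantumFieldTheory.Balaban1983to89
open Literature.MathematicalPhysics.QuantumFieldTheory.Balaban1983to89.B9SectDWalk (Through MajSumLe passDist)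
open Literature.MathematicalPhysics.QuantumFieldTheory.Balaban1983to89.B9SectDWalkThrough (subfamily_through_sum_le)
open Literature.MathematicalPhysics.QuantumFieldTheory.Balaban1983to89.B9Thm34Ext (toB6)
open Literature.MathematicalPhysics.QuantumFieldTheory.Balaban1983to89.B9Thm37GlueTorus
  (torusGeom tdist1 tdist1_nonneg tdist1_triangle tdist1_self tdist1_comm)
open Literature.MathematicalPhysics.QuantumFieldTheory.Balaban1983to89.TreeLengthTorus (TPt)
open Literature.MathematicalPhysics.QuantumFieldTheory.Balaban1983to89.B5TorusCover (UT)
open Literature.MathematicalPhysics.QuantumFieldTheory.Balaban1983to89.B13SigmaThroughWalks (SigmaThroughWalks)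
open Literature.MathematicalPhysics.QuantumFieldTheory.Balaban1983to89.B13JointWalkExpansion (JointWalkExpansion)
open Literature.MathematicalPhysics.QuantumFieldTheory.Balaban1983to89.NodeOLetters
  (distX distX_eq distX_nonneg tdist1_le_distX KernelLetters TermLetters)
open Literature.MathematicalPhysics.QuantumFieldTheory.Balaban1983to89.NodeOLettersSqrt (kernelLetters_mul)
open Literature.MathematicalPhysics.QuantumFieldTheory.Balaban1983to89.NodeOLettersSqrtAlmostLocal (kernelLetters_mono_rate)
open Literature.MathematicalPhysics.QuantumFieldTheory.Balaban1983to89.NodeOLettersSqrtExpDecay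
  (weightedSums_le_half_of_expDecay kernelLetters_invSqrt_of_expDecay)
open Literature.MathematicalPhysics.QuantumFieldTheory.Balaban1983to89.B13Sqrt27Accretive (invSqrt)

/-! ## §1. The σ-difference of a kernel with `SigmaThroughWalks` data, in the inf-convolution distance through `X` -/

section Abstract

variable {g : B6.Geometry}
variable {S : Type*} {P : Set S} {s₀ : S} {p n : Type} {locp : p → g.Site} {locn : n → g.Site}
variable {K : S → Matrix p n ℂ} {W : Type} {T : W → S → Matrix p n ℂ} {SX : Set W} {X : Finset g.Site}
variable {A : W → ℝ} {D : W → g.Site → g.Site → ℝ} {ρ : ℝ}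

/-- **THE σ-DIFFERENCE THROUGH `X`, POINTWISE IN THE END POINTS.**  If `s ↦ K(s)` has `SigmaThroughWalks` data (entrywise
convergent expansion, σ carried only by the sub-family `SX` of walks passing THROUGH `X`, per-term bounds `A_ω e^{−ρD_ω}` uniform on
the parameter set) and the reduced-rate majorant family `(A_ω e^{−(ρ−ε)D_ω})_ω` has partial sums `≤ K̄` (`ε ≥ 0`), then for all
parameters `s, s₀ ∈ P` and all entries `‖(K(s) − K(s₀))(i,j)‖ ≤ 2·K̄(loc i, loc j)·e^{−ε·D_X(loc i, loc j)}` with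
`D_X(y,y′) = min_{z∈X}(d(y,z) + d(z,y′))` (`B9SectDWalk.passDist`): the difference is the sum of `T_ω(s) − T_ω(s₀)` over `ω ∈ SX`,
each `≤` twice its majorant, and that sub-family passes through `X` (`B9SectDWalkThrough.subfamily_through_sum_le`, (3.154)).  The tree's
`B13SigmaThroughWalks.sub_ref_entry_le` is the corollary `D_X ≥ R` under far-ness of the rows.
[cite: Balaban1985BackgroundPropagators, (3.93) p.410, (3.154) p.427; Balaban1988RG2Cluster, p.13, (2.16) p.16] -/
theorem sub_ref_entry_le_passDist (h : SigmaThroughWalks g P s₀ locp locn K T SX X A D ρ) (h₀ : s₀ ∈ P)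
    (hX : X.Nonempty) {ε : ℝ} (hε : 0 ≤ ε) {Kbar : g.Site → g.Site → ℝ}
    (hsum : MajSumLe (fun ω a b => A ω * Real.exp (-((ρ - ε) * D ω a b))) Kbar)
    {s : S} (hs : s ∈ P) (i : p) (j : n) :
    ‖(K s - K s₀) i j‖ ≤ 2 * Kbar (locp i) (locn j) * Real.exp (-(ε * passDist X hX (locp i) (locn j))) := by
  classical
  -- the entrywise difference is the sum of the term differences
  have hdiff : HasSum (fun ω => T ω s i j - T ω s₀ i j) ((K s - K s₀) i j) := by
    rw [Matrix.sub_apply]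
    exact (h.hasSum s hs i j).sub (h.hasSum s₀ h₀ i j)
  -- the majorant family: twice the per-term bound on the σ-carrying sub-family, zero elsewhere
  obtain ⟨m, hm⟩ : ∃ m : W → ℝ,
      ∀ ω, m ω = if ω ∈ SX then 2 * (A ω * Real.exp (-(ρ * D ω (locp i) (locn j)))) else 0 :=
    ⟨fun ω => if ω ∈ SX then 2 * (A ω * Real.exp (-(ρ * D ω (locp i) (locn j)))) else 0, fun _ => rfl⟩
  have hle : ∀ ω, ‖T ω s i j - T ω s₀ i j‖ ≤ m ω := by
    intro ω
    by_cases hω : ω ∈ SX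
    · rw [hm ω, if_pos hω, two_mul]
      exact (norm_sub_le _ _).trans (add_le_add (h.maj ω s hs i j) (h.maj ω s₀ h₀ i j))
    · rw [hm ω, if_neg hω, h.indep ω hω s hs, sub_self, norm_zero]
  have hm0 : ∀ ω, 0 ≤ m ω := fun ω => (norm_nonneg _).trans (hle ω)
  -- its partial sums are sub-family sums THROUGH `X`, bounded by `subfamily_through_sum_le`
  have hpart : ∀ Sf : Finset W,
      ∑ ω ∈ Sf, m ω ≤ 2 * Kbar (locp i) (locn j) * Real.exp (-(ε * passDist X hX (locp i) (locn j))) := by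
    intro Sf
    have hrew : ∑ ω ∈ Sf, m ω =
        2 * ∑ ω ∈ Sf.filter (fun ω => ω ∈ SX), A ω * Real.exp (-(ρ * D ω (locp i) (locn j))) := by
      rw [Finset.sum_filter, Finset.mul_sum]
      refine Finset.sum_congr rfl fun ω _ => ?_
      rw [hm ω]
      split_ifs <;> simp
    rw [hrew, mul_assoc]
    refine mul_le_mul_of_nonneg_left ?_ (by norm_num)
    exact subfamily_through_sum_le hX hε h.A_nonneg hsum (Sf.filter (fun ω => ω ∈ SX))
      (fun ω hω => h.through ω (Finset.mem_filter.1 hω).2) (locp i) (locn j)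
  have hmsum : Summable m := summable_of_sum_le (fun ω => hm0 ω) hpart
  exact (hdiff.norm_le_of_bounded hmsum.hasSum hle).trans (hmsum.tsum_le_of_sum_le hpart)

end Abstract

section Torus

variable {d N' : ℕ} {ν : ℕ} {Nf : Fin ν → ℕ} [∀ i, NeZero (Nf i)]
variable {p n : Type}

/-- On the one-scale ℓ¹ site torus the walk vocabulary's `passDist` ([B9] (3.93)) IS the letters' inf-convolution distance
`NodeOLetters.distX` (both are `min_{z∈X}(d₁(a,z) + d₁(z,b))`; `X ≠ ∅`). [cite: Balaban1985BackgroundPropagators, (3.93) p.410] -/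
theorem distX_eq_passDist {X : Finset (UT Nf)} (hX : X.Nonempty) (a b : UT Nf) :
    distX X a b = passDist (g := toB6 (torusGeom Nf 0 0 0) 0 True) X hX a b := by
  rw [distX, dif_pos hX]
  rfl

/-- **LETTER (L2) FROM THE WALK STRUCTURE, on the site torus, MIXED RATE.**  For a kernel family `σ ↦ K(σ)` (rows `p`, columns `n`
located on the site torus by `locp`, `locn`) with `SigmaThroughWalks` data over the ℓ¹ torus geometry on the σ-polydisc `‖σ_j‖ ≤ e^{κ₁}`
with reference `σ = 0`, whose reduced-rate majorant family (drop `ε ≥ 0`) has partial sums `≤ K̄₀e^{−κd₁}`: for every σ of the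
polydisc, `‖(K σ − K 0)(b,j)‖ ≤ 2K̄₀·e^{−κd₁(loc b, loc j)}·e^{−ε·d_X(loc b, loc j)}` — σ-dependence is as small as the passage
through the σ-carrying region `X` is long (print p. 13: the cubes of `σ₀` lie outside `Z̃₀`; p. 16: the factor `e^{−⅓δ₀M}` of (2.16)).
[cite: Balaban1988RG2Cluster, p.13, (2.16) p.16; Balaban1985BackgroundPropagators, (3.154) p.427] -/
theorem sub_ref_le_mixed_of_sigmaThroughWalks (c : B13.Consts) (locp : p → UT Nf) (locn : n → UT Nf)
    (K : (TPt d N' → ℂ) → Matrix p n ℂ) {W : Type} {T : W → (TPt d N' → ℂ) → Matrix p n ℂ} {SX : Set W}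
    {X : Finset (UT Nf)} {A : W → ℝ} {D : W → UT Nf → UT Nf → ℝ} {ρ ε kap Kbar₀ : ℝ}
    (h : SigmaThroughWalks (toB6 (torusGeom Nf 0 0 0) 0 True) {σ : TPt d N' → ℂ | ∀ j, ‖σ j‖ ≤ Real.exp c.κ₁} 0
      locp locn K T SX X A D ρ)
    (hX : X.Nonempty) (hε : 0 ≤ ε)
    (hsum : MajSumLe (g := toB6 (torusGeom Nf 0 0 0) 0 True)
      (fun ω a b => A ω * Real.exp (-((ρ - ε) * D ω a b))) (fun a b => Kbar₀ * Real.exp (-(kap * tdist1 Nf a b)))) :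
    ∀ σ : TPt d N' → ℂ, (∀ j, ‖σ j‖ ≤ Real.exp c.κ₁) → ∀ b j,
      ‖(K σ - K 0) b j‖ ≤ 2 * Kbar₀ * Real.exp (-(kap * tdist1 Nf (locp b) (locn j))) *
        Real.exp (-(ε * distX X (locp b) (locn j))) := by
  intro σ hσ b j
  have h₀ : (0 : TPt d N' → ℂ) ∈ {σ : TPt d N' → ℂ | ∀ j, ‖σ j‖ ≤ Real.exp c.κ₁} := fun _ => by
    rw [Pi.zero_apply, norm_zero]; exact (Real.exp_pos _).le
  have key := sub_ref_entry_le_passDist h h₀ hX hε hsum hσ b j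
  rw [distX_eq_passDist hX]
  calc ‖(K σ - K 0) b j‖
      ≤ 2 * (Kbar₀ * Real.exp (-(kap * tdist1 Nf (locp b) (locn j)))) *
          Real.exp (-(ε * passDist (g := toB6 (torusGeom Nf 0 0 0) 0 True) X hX (locp b) (locn j))) := key
    _ = _ := by ring

/-- **LETTER (L2) FROM THE WALK STRUCTURE, PURE `d_X` RATE** (`κ ≥ 0`, `K̄₀ ≥ 0`): under the hypotheses of
`sub_ref_le_mixed_of_sigmaThroughWalks`, `‖(K σ − K 0)(b,j)‖ ≤ 2K̄₀·e^{−ε·d_X(loc b, loc j)}` — literally the `sigmaLoc` clause of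
`NodeOLetters.KernelLetters` (constant `B′ = 2K̄₀`, rate `ε` = the drop of the expansion) and the binder `hPloc` of the square-root
recipes (`B₀ = 2K̄₀`, `ρ₀ = ε`). [cite: Balaban1988RG2Cluster, p.13, (2.16) p.16; Balaban1985BackgroundPropagators, (3.154) p.427] -/
theorem sigmaLoc_of_sigmaThroughWalks (c : B13.Consts) (locp : p → UT Nf) (locn : n → UT Nf)
    (K : (TPt d N' → ℂ) → Matrix p n ℂ) {W : Type} {T : W → (TPt d N' → ℂ) → Matrix p n ℂ} {SX : Set W}
    {X : Finset (UT Nf)} {A : W → ℝ} {D : W → UT Nf → UT Nf → ℝ} {ρ ε kap Kbar₀ : ℝ}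
    (h : SigmaThroughWalks (toB6 (torusGeom Nf 0 0 0) 0 True) {σ : TPt d N' → ℂ | ∀ j, ‖σ j‖ ≤ Real.exp c.κ₁} 0
      locp locn K T SX X A D ρ)
    (hX : X.Nonempty) (hε : 0 ≤ ε) (hkap : 0 ≤ kap) (hK : 0 ≤ Kbar₀)
    (hsum : MajSumLe (g := toB6 (torusGeom Nf 0 0 0) 0 True)
      (fun ω a b => A ω * Real.exp (-((ρ - ε) * D ω a b))) (fun a b => Kbar₀ * Real.exp (-(kap * tdist1 Nf a b)))) :
    ∀ σ : TPt d N' → ℂ, (∀ j, ‖σ j‖ ≤ Real.exp c.κ₁) → ∀ b j,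
      ‖(K σ - K 0) b j‖ ≤ 2 * Kbar₀ * Real.exp (-(ε * distX X (locp b) (locn j))) := by
  intro σ hσ b j
  refine (sub_ref_le_mixed_of_sigmaThroughWalks c locp locn K h hX hε hsum σ hσ b j).trans ?_
  have h1 : Real.exp (-(kap * tdist1 Nf (locp b) (locn j))) ≤ 1 :=
    Real.exp_le_one_iff.2 (neg_nonpos.2 (mul_nonneg hkap (tdist1_nonneg _ _)))
  calc 2 * Kbar₀ * Real.exp (-(kap * tdist1 Nf (locp b) (locn j))) * Real.exp (-(ε * distX X (locp b) (locn j)))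
      ≤ 2 * Kbar₀ * 1 * Real.exp (-(ε * distX X (locp b) (locn j))) := by gcongr
    _ = 2 * Kbar₀ * Real.exp (-(ε * distX X (locp b) (locn j))) := by ring

end Torus

/-! ## §2. `KernelLetters` (L1)–(L3) FROM a `JointWalkExpansion` — the converse of `NodeOLetters.jointWalkExpansion_of_letters` -/

section Letters

variable {d N' : ℕ} {ν : ℕ} {Nf : Fin ν → ℕ} [∀ i, NeZero (Nf i)]
variable {p n : Type}
variable {E : Type*} [NormedAddCommGroup E] [NormedSpace ℂ E]

/-- The summability constant of a joint walk expansion through a nonempty `X` is `≥ 0` (empty partial sum at a point of `X`).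
[cite: Balaban1985BackgroundPropagators, Thm 3.10 p.416] -/
theorem kbar_nonneg_of_jointWalkExpansion {c : B13.Consts} {locp : p → UT Nf} {locn : n → UT Nf}
    {K2 : (TPt d N' → ℂ) → E → Matrix p n ℂ} {X : Finset (UT Nf)} {R ε kap Kbar : ℝ}
    {W : Type} {T2 : W → (TPt d N' → ℂ) → E → Matrix p n ℂ} {SX : Set W} {A : W → ℝ} {D : W → UT Nf → UT Nf → ℝ} {ρw : ℝ}
    (h : JointWalkExpansion c locp locn K2 X R ε kap Kbar T2 SX A D ρw) (hX : X.Nonempty) : 0 ≤ Kbar := by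
  obtain ⟨z, _⟩ := hX
  have h0 := h.majSum.nonneg z z
  have e : tdist1 Nf z z = 0 := tdist1_self z
  simp only [e, mul_zero, neg_zero, Real.exp_zero, mul_one] at h0
  exact h0

/-- **NODE O's LETTERS (L1)–(L3) OF A KERNEL FAMILY FROM ITS JOINT WALK EXPANSION** ([B9] Thm 3.10 shape ⟹ the walk-free letters).
A `JointWalkExpansion` of `K(σ,u)` through `X` (`X ≠ ∅`) on the `R`-ball (`R > 0`) with drop `ε ≥ 0`, torus rate `κ ≥ 0` and summability
constant `K̄` yields, at EVERY rate `ρ₀ ≤ min(κ, ε)`: (L1) `‖K(σ,u)_{ij}‖ ≤ K̄e^{−ρ₀d₁}` (`JointWalkExpansion.majorants`); (L2)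
`‖(K(σ,0) − K(0,0))_{ij}‖ ≤ 2K̄e^{−ρ₀d_X}` (§1 on the σ-section at the reference background, `JointWalkExpansion.sigmaThroughWalks`);
(L3) entrywise `u`-holomorphy (`JointWalkExpansion.analyticOnBall` = `B13ExpansionAnalytic`, termwise analyticity + Cauchy estimates).
So `KernelLetters c locp locn K X R ρ₀ K̄ (2K̄)`.  (The letters lose the rate split: decay at `κ`, σ-localisation at the drop `ε`;
`NodeOLetters.jointWalkExpansion_of_letters` goes back with TWO terms.) [cite: Balaban1985BackgroundPropagators, Thm 3.10 p.416, (3.154) p.427; Balaban1988RG2Cluster, p.13, p.15, (2.16) p.16] -/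
theorem kernelLetters_of_jointWalkExpansion {c : B13.Consts} {locp : p → UT Nf} {locn : n → UT Nf}
    {K2 : (TPt d N' → ℂ) → E → Matrix p n ℂ} {X : Finset (UT Nf)} {R ε kap Kbar : ℝ}
    {W : Type} {T2 : W → (TPt d N' → ℂ) → E → Matrix p n ℂ} {SX : Set W} {A : W → ℝ} {D : W → UT Nf → UT Nf → ℝ} {ρw : ℝ}
    (h : JointWalkExpansion c locp locn K2 X R ε kap Kbar T2 SX A D ρw) (hX : X.Nonempty) (hR : 0 < R) (hε : 0 ≤ ε)
    (hkap : 0 ≤ kap) {ρ₀ : ℝ} (hρk : ρ₀ ≤ kap) (hρε : ρ₀ ≤ ε) :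
    KernelLetters c locp locn K2 X R ρ₀ Kbar (2 * Kbar) := by
  have hK : 0 ≤ Kbar := kbar_nonneg_of_jointWalkExpansion h hX
  refine ⟨?_, ?_, h.analyticOnBall hε, hK, by positivity⟩
  · -- (L1) plain decay at rate `ρ₀ ≤ κ`
    intro σ hσ u hu i j
    refine (h.majorants hε σ hσ u hu i j).trans (mul_le_mul_of_nonneg_left (Real.exp_le_exp.2 (neg_le_neg ?_)) hK)
    exact mul_le_mul_of_nonneg_right hρk (tdist1_nonneg _ _)
  · -- (L2) σ-localisation through `X` at rate `ρ₀ ≤ ε`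
    intro σ hσ i j
    have h2 := sigmaLoc_of_sigmaThroughWalks c locp locn (fun σ => K2 σ 0) (h.sigmaThroughWalks hR) hX hε hkap hK h.majSum
      σ hσ i j
    rw [Matrix.sub_apply] at h2
    refine h2.trans (mul_le_mul_of_nonneg_left (Real.exp_le_exp.2 (neg_le_neg ?_)) (by positivity))
    exact mul_le_mul_of_nonneg_right hρε (distX_nonneg X _ _)

/-- **THE THREE PRECISION-LEVEL LETTERS OF THE SQUARE-ROOT RECIPE FROM A JOINT WALK EXPANSION OF THE PRECISION**: a
`JointWalkExpansion` of `P(σ,u)` through `X` (drop `ε ≥ 0`, rate `κ_P`, constant `K̄_P`) gives the binders `hdec` (`a = K̄_P`, `κ₀ = κ_P`),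
`hPloc` (`B₀ = 2K̄_P`, `ρ₀ = ε`) and `hPholo` of `NodeOLettersSqrtExpDecay.kernelLetters_invSqrt_of_expDecay` ∕ §3 verbatim.
[cite: Balaban1985BackgroundPropagators, Thm 3.10 p.416; Balaban1988RG2Cluster, (2.7) p.13, p.15, (2.16) p.16] -/
theorem precisionLetters_of_jointWalkExpansion {c : B13.Consts} {Λ : Type} {locΛ : Λ → UT Nf}
    {P : (TPt d N' → ℂ) → E → Matrix Λ Λ ℂ} {X : Finset (UT Nf)} {R ε kap Kbar : ℝ}
    {W : Type} {T2 : W → (TPt d N' → ℂ) → E → Matrix Λ Λ ℂ} {SX : Set W} {A : W → ℝ} {D : W → UT Nf → UT Nf → ℝ} {ρw : ℝ}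
    (h : JointWalkExpansion c locΛ locΛ P X R ε kap Kbar T2 SX A D ρw) (hX : X.Nonempty) (hR : 0 < R) (hε : 0 ≤ ε)
    (hkap : 0 ≤ kap) :
    (∀ σ : TPt d N' → ℂ, (∀ j, ‖σ j‖ ≤ Real.exp c.κ₁) → ∀ u ∈ ball (0 : E) R,
        ∀ i l, ‖P σ u i l‖ ≤ Kbar * Real.exp (-(kap * tdist1 Nf (locΛ i) (locΛ l)))) ∧
      (∀ σ : TPt d N' → ℂ, (∀ j, ‖σ j‖ ≤ Real.exp c.κ₁) →
        ∀ k l, ‖(P σ 0 - P 0 0) k l‖ ≤ 2 * Kbar * Real.exp (-(ε * distX X (locΛ k) (locΛ l)))) ∧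
      (∀ σ : TPt d N' → ℂ, (∀ j, ‖σ j‖ ≤ Real.exp c.κ₁) →
        ∀ i j, DifferentiableOn ℂ (fun u => P σ u i j) (ball (0 : E) R)) :=
  ⟨h.majorants hε,
    sigmaLoc_of_sigmaThroughWalks c locΛ locΛ (fun σ => P σ 0) (h.sigmaThroughWalks hR) hX hε hkap
      (kbar_nonneg_of_jointWalkExpansion h hX) h.majSum,
    h.analyticOnBall hε⟩

end Letters

/-! ## §3. `TermLetters` of a «local factor × square root» term with the precisions' letters in EXPONENTIAL-DECAY currency -/

section Term

variable {d N' : ℕ} {ν : ℕ} {Nf : Fin ν → ℕ} [∀ i, NeZero (Nf i)]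
variable {E : Type*} [NormedAddCommGroup E] [NormedSpace ℂ E]

/-- Volume sums are antitone in the rate (`d₁ ≥ 0`): a volume bound at rate `η` serves every rate `θ ≥ η`. [folklore] -/
private theorem volume_mono {ι : Type} [Fintype ι] (f : ι → UT Nf) (a : UT Nf) {η θ cV : ℝ}
    (hηθ : η ≤ θ) (h : ∑ k, Real.exp (-(η * tdist1 Nf a (f k))) ≤ cV) :
    ∑ k, Real.exp (-(θ * tdist1 Nf a (f k))) ≤ cV :=
  (Finset.sum_le_sum fun _ _ => Real.exp_le_exp.2
    (neg_le_neg (mul_le_mul_of_nonneg_right hηθ (tdist1_nonneg _ _)))).trans h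

/-- **`TermLetters` OF A TERM WITH Γ-KERNEL `G2(σ,u) = L(σ,u)·P(σ,u)^{−1/2}` — EXPONENTIAL-DECAY EDITION of
`NodeOLettersSqrtAlmostLocal.termLetters_of_sqrtFactor`.**  Inputs: the term's kernel record `𝒦` with the product reading `hG2`
([II] p. 13∕15: `Γ_k(Z₀,σ) = C*Δ_k(σ)C_{Z₀ᶜ}·(C^{(k)})^{1/2}(σ)`); `KernelLetters` of the local factor `L` (rate `ρ_L`); for the FULL
precision `P`: `m`-accretivity, the EXPONENTIAL-DECAY letter `‖P(σ,u)_{il}‖ ≤ a·e^{−κ₀d₁}` (`κ₀ > 0`), σ-localisation through `X`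
(`B₀`, `ρ₀P`) and holomorphy — NO weighted-sum hypothesis: the Combes–Thomas rate `κ` is any number with `0 ≤ κ ≤ κ₀/4`,
`8aκc_V ≤ mκ₀` (`NodeOLettersSqrtExpDecay`); for the term's precision `𝒦.A2`: its `KernelLetters` (rate `ρ_E > 0`, constant `B_E` —
they CONTAIN its decay letter) and `m_A`-accretivity — its covariance letter `‖(A2(σ,u))⁻¹_{ij}‖ ≤ (4/m_A)e^{−κ_A d₁}` is DERIVED for
any `0 ≤ κ_A ≤ ρ_E/4` with `8B_Eκ_Ac_V ≤ m_Aρ_E` (`weightedSums_le_half_of_expDecay` + `almostLocal_inverse_decay`); ONE volume constant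
`c_V` at ONE rate `η` (`0 ≤ η ≤ min(κ₀, ρ_E)/2`) on the four location pairings; rates `ρ′ + η ≤ ρ₀ ≤ min(ρ_L, θ′)`, `θ′ ≤ ρ₀P`,
`θ′ + η ≤ κ`, `ρ′ ≤ ρ_E`; the geometric clause `hfar`.  Output:
`TermLetters 𝒦 R ρ′ κ_A (B_L·(4/√m)·c_V) ((B_L′·(4/√m) + B_L·16B₀c_V²/(m√m))·c_V) B_E B_E′ (4/m_A) R_σ`.
[cite: Balaban1988RG2Cluster, (2.14)–(2.16) pp.15–16, (2.7) p.13; Balaban1985BackgroundPropagators, Thm 3.10 p.416] -/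
theorem termLetters_of_sqrtFactor_expDecay {c : B13.Consts} (𝒦 : B13TermWalkData.TermKernels c d N' ν Nf E)
    [Fintype 𝒦.C₀] [DecidableEq 𝒦.C₀] (hX : 𝒦.X.Nonempty)
    (L : (TPt d N' → ℂ) → E → Matrix 𝒦.Λ (𝒦.Λ ⊕ 𝒦.C₀) ℂ)
    (P : (TPt d N' → ℂ) → E → Matrix (𝒦.Λ ⊕ 𝒦.C₀) (𝒦.Λ ⊕ 𝒦.C₀) ℂ)
    (hG2 : ∀ σ u, 𝒦.G2 σ u = L σ u * invSqrt (P σ u))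
    {R ρL BL BL' m a κ₀ κ B₀ ρ₀P θ' ρE BE BE' mA κA η cV ρ₀ ρ' Rσ : ℝ}
    (hR : 0 < R) (hη : 0 ≤ η) (hρ' : 0 ≤ ρ') (hsplit : ρ' + η ≤ ρ₀) (hρ₀L : ρ₀ ≤ ρL) (hρ₀S : ρ₀ ≤ θ') (hρE : ρ' ≤ ρE)
    -- letters of the local factor
    (hL : KernelLetters c 𝒦.locΛ 𝒦.locN L 𝒦.X R ρL BL BL')
    -- the full precision `P`: accretivity, exponential-decay letter, σ-localisation, holomorphy; Combes–Thomas rate `κ`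
    (hm : 0 < m) (ha : 0 ≤ a) (hκ₀ : 0 < κ₀) (hκ : 0 ≤ κ) (hκ4 : κ ≤ κ₀ / 4) (hκm : 8 * a * κ * cV ≤ m * κ₀)
    (hηκ₀ : η ≤ κ₀ / 2) (hB₀ : 0 ≤ B₀) (hθ' : 0 ≤ θ') (hθ'ρ : θ' ≤ ρ₀P) (hθ'η : θ' + η ≤ κ)
    (hPacc : ∀ σ : TPt d N' → ℂ, (∀ j, ‖σ j‖ ≤ Real.exp c.κ₁) → ∀ u ∈ ball (0 : E) R,
      ∀ v : 𝒦.Λ ⊕ 𝒦.C₀ → ℂ, m * ∑ i, ‖v i‖ ^ 2 ≤ (∑ i, star (v i) * (P σ u *ᵥ v) i).re)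
    (hPdec : ∀ σ : TPt d N' → ℂ, (∀ j, ‖σ j‖ ≤ Real.exp c.κ₁) → ∀ u ∈ ball (0 : E) R,
      ∀ i l, ‖P σ u i l‖ ≤ a * Real.exp (-(κ₀ * tdist1 Nf (𝒦.locN i) (𝒦.locN l))))
    (hPloc : ∀ σ : TPt d N' → ℂ, (∀ j, ‖σ j‖ ≤ Real.exp c.κ₁) →
      ∀ k l, ‖(P σ 0 - P 0 0) k l‖ ≤ B₀ * Real.exp (-(ρ₀P * distX 𝒦.X (𝒦.locN k) (𝒦.locN l))))
    (hPholo : ∀ σ : TPt d N' → ℂ, (∀ j, ‖σ j‖ ≤ Real.exp c.κ₁) →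
      ∀ i j, DifferentiableOn ℂ (fun u => P σ u i j) (ball (0 : E) R))
    -- the term's precision `𝒦.A2`: letters + accretivity; Combes–Thomas rate `κ_A`
    (hE : KernelLetters c 𝒦.locΛ 𝒦.locΛ 𝒦.A2 𝒦.X R ρE BE BE') (hρEpos : 0 < ρE) (hηρE : η ≤ ρE / 2)
    (hmA : 0 < mA) (hκA : 0 ≤ κA) (hκA4 : κA ≤ ρE / 4) (hκAm : 8 * BE * κA * cV ≤ mA * ρE)
    (hAacc : ∀ σ : TPt d N' → ℂ, (∀ j, ‖σ j‖ ≤ Real.exp c.κ₁) → ∀ u ∈ ball (0 : E) R,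
      ∀ v : 𝒦.Λ → ℂ, mA * ∑ i, ‖v i‖ ^ 2 ≤ (∑ i, star (v i) * (𝒦.A2 σ u *ᵥ v) i).re)
    -- volume sums at rate `η`
    (hvolN : ∀ i : 𝒦.Λ ⊕ 𝒦.C₀, ∑ k : 𝒦.Λ ⊕ 𝒦.C₀, Real.exp (-(η * tdist1 Nf (𝒦.locN i) (𝒦.locN k))) ≤ cV)
    (hvolN' : ∀ j : 𝒦.Λ ⊕ 𝒦.C₀, ∑ l : 𝒦.Λ ⊕ 𝒦.C₀, Real.exp (-(η * tdist1 Nf (𝒦.locN l) (𝒦.locN j))) ≤ cV)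
    (hvolΛN : ∀ i : 𝒦.Λ, ∑ k : 𝒦.Λ ⊕ 𝒦.C₀, Real.exp (-(η * tdist1 Nf (𝒦.locΛ i) (𝒦.locN k))) ≤ cV)
    (hvolΛ : ∀ i : 𝒦.Λ, ∑ k : 𝒦.Λ, Real.exp (-(η * tdist1 Nf (𝒦.locΛ i) (𝒦.locΛ k))) ≤ cV) (hcV : 0 ≤ cV)
    -- geometry
    (hfar : ∀ b : 𝒦.Λ, ∀ z ∈ 𝒦.X, Rσ ≤ tdist1 Nf (𝒦.locΛ b) z) :
    TermLetters 𝒦 R ρ' κA (BL * (4 / Real.sqrt m) * cV)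
      ((BL' * (4 / Real.sqrt m) + BL * (16 * B₀ * cV ^ 2 / (m * Real.sqrt m))) * cV) BE BE' (4 / mA) Rσ := by
  -- half-rate volume sums for `P` from the rate-`η` ones (`η ≤ κ₀/2`)
  have hvol₀ : ∀ i : 𝒦.Λ ⊕ 𝒦.C₀, ∑ l : 𝒦.Λ ⊕ 𝒦.C₀,
      Real.exp (-(κ₀ / 2 * tdist1 Nf (𝒦.locN i) (𝒦.locN l))) ≤ cV :=
    fun i => volume_mono (fun l => 𝒦.locN l) (𝒦.locN i) hηκ₀ (hvolN i)
  -- the square-root factor's letters, on the columns' locations (exp-decay edition)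
  have hS : KernelLetters c 𝒦.locN 𝒦.locN (fun σ u => invSqrt (P σ u)) 𝒦.X R θ' (4 / Real.sqrt m)
      (16 * B₀ * cV ^ 2 / (m * Real.sqrt m)) :=
    kernelLetters_invSqrt_of_expDecay c 𝒦.locN hX P hR hm ha hκ₀ hκ hκ4 hκm hη hB₀ hθ' hθ'ρ hθ'η hPacc hPdec hvol₀
      hPloc hPholo hvolN hvolN'
  -- both factors at the common rate `ρ₀`, then the product at rate `ρ'`
  have hL₀ := kernelLetters_mono_rate c hρ₀L hL
  have hS₀ := kernelLetters_mono_rate c hρ₀S hS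
  have hprod := kernelLetters_mul c hX hR hρ' hη hsplit hcV hL₀ hS₀ hvolΛN hvolN'
  have hG : 𝒦.G2 = fun σ u => L σ u * invSqrt (P σ u) := funext fun σ => funext fun u => hG2 σ u
  have hΓ : KernelLetters c 𝒦.locΛ 𝒦.locN 𝒦.G2 𝒦.X R ρ' (BL * (4 / Real.sqrt m) * cV)
      ((BL' * (4 / Real.sqrt m) + BL * (16 * B₀ * cV ^ 2 / (m * Real.sqrt m))) * cV) := by
    rw [hG]; exact hprod
  -- the covariance letter: `A2`'s decay letter ⟹ weighted sums `≤ m_A/2` at rate `κ_A` ⟹ almost-local Combes–Thomas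
  have hBE : 0 ≤ BE := hE.B_nonneg
  set dd : 𝒦.Λ → 𝒦.Λ → ℝ := fun i l => tdist1 Nf (𝒦.locΛ i) (𝒦.locΛ l) with hdd
  have hdnn : ∀ i l, 0 ≤ dd i l := fun i l => tdist1_nonneg _ _
  have hvolA : ∀ i : 𝒦.Λ, ∑ l : 𝒦.Λ, Real.exp (-(ρE / 2 * dd i l)) ≤ cV :=
    fun i => volume_mono (fun l => 𝒦.locΛ l) (𝒦.locΛ i) hηρE (hvolΛ i)
  have hvolA' : ∀ l : 𝒦.Λ, ∑ i : 𝒦.Λ, Real.exp (-(ρE / 2 * dd i l)) ≤ cV := by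
    intro l
    have e : ∀ i, dd i l = dd l i := fun i => tdist1_comm _ _
    simpa [e] using hvolA l
  have hC : ∀ σ : TPt d N' → ℂ, (∀ j, ‖σ j‖ ≤ Real.exp c.κ₁) → ∀ u ∈ ball (0 : E) R,
      ∀ i j, ‖(𝒦.A2 σ u)⁻¹ i j‖ ≤ 4 / mA * Real.exp (-(κA * tdist1 Nf (𝒦.locΛ i) (𝒦.locΛ j))) := by
    intro σ hσ u hu i j
    have hW := weightedSums_le_half_of_expDecay dd hdnn (𝒦.A2 σ u) hBE hρEpos hκA hκA4 hκAm
      (fun i l => hE.decay σ hσ u hu i l) hvolA hvolA'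
    exact (B13Sqrt27AccretiveAlmostLocal.almostLocal_inverse_decay dd (fun a => tdist1_self _) (fun a b => tdist1_comm _ _)
      (fun a b e => tdist1_triangle _ _ _) (𝒦.A2 σ u) hmA hκA (by positivity : (0 : ℝ) ≤ mA / 2) le_rfl (hAacc σ hσ u hu)
      hW.1 hW.2).2 i j
  exact ⟨hX, hΓ, kernelLetters_mono_rate c hρE hE, hC, by positivity, hfar⟩

/-! ## §4. THE CAPSTONE: `TermLetters` from three joint walk expansions + accretivity -/

/-- **`TermLetters` OF A «LOCAL FACTOR × SQUARE ROOT» TERM FROM [B9]-SHAPED DATA ONLY.**  Inputs, all at complex background on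
polydisc `‖σ_j‖ ≤ e^{κ₁}` × ball `‖u‖ < R`:
* joint walk expansions ([B9] Thm 3.10 shape, `B13JointWalkExpansion.JointWalkExpansion`) through the term's `X` of the LOCAL factor
  `L(σ,u)` (drop `ε_L ≥ 0`, rate `κ_L ≥ 0`, constant `K̄_L`), of the FULL precision `P(σ,u)` (`ε_P ≥ 0`, `κ_P > 0`, `K̄_P`) and of the
  term's precision `𝒦.A2(σ,u)` (`ε_A`, `κ_A⁰` with `min > 0`, `K̄_A`) — print p. 13: *"This construction was discussed in [13] for all
  operators determining Δ_k, and for C^{(k)}(Z₀)"*;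
* accretivity of `P` (constant `m`) and of `A2` (`m_A`) — print p. 15, *"the general case is handled by a perturbative argument"*
  (tree: `B13Sqrt27AccretiveSquare.accretive_of_isSymm_re_coercive`, `B13Sqrt27Accretive.accretive_of_coercive_add`);
* the product reading `𝒦.G2 σ u = L σ u · (P σ u)^{−1/2}` of `Γ_k(Z₀,σ)`, (2.7);
* ONE volume constant `c_V ≥ 0` at ONE rate `η ≥ 0` on the four location pairings, the far-ness `d₁(loc b, X) ≥ R_σ` of the rows;
* rate bookkeeping: Combes–Thomas rates `0 ≤ κ ≤ κ_P/4` with `8K̄_Pκc_V ≤ mκ_P` and `0 ≤ κ_C ≤ ρ_E/4` with `8K̄_Aκ_Cc_V ≤ m_Aρ_E`,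
  where `0 < ρ_E ≤ min(κ_A⁰, ε_A)`; `η ≤ min(κ_P, ρ_E)/2`; `0 ≤ θ′ ≤ ε_P`, `θ′ + η ≤ κ`; `0 ≤ ρ_L ≤ min(κ_L, ε_L)`;
  `0 ≤ ρ′`, `ρ′ + η ≤ ρ₀ ≤ min(ρ_L, θ′)`, `ρ′ ≤ ρ_E` (jointly satisfiable with `ρ′, κ_C > 0`: §5).
Output: `TermLetters 𝒦 R ρ′ κ_C (K̄_L·(4/√m)·c_V) ((2K̄_L·(4/√m) + K̄_L·16·(2K̄_P)·c_V²/(m√m))·c_V) K̄_A (2K̄_A) (4/m_A) R_σ` — hence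
`TermWalkData` (`NodeOLetters.termWalkData_of_letters`) and L17a ∧ L16a of (2.26) for the term, with every constant an explicit function
of the inputs'.  Nothing of Bałaban's operators is constructed; the three expansions and the two accretivity constants for HIS kernels,
k-uniformly, are the in-edge's ([13]) and the pin's content. [cite: Balaban1988RG2Cluster, (2.7) p.13, p.15, (2.14)–(2.16) pp.15–16; Balaban1985BackgroundPropagators, Thm 3.10 p.416, (3.154) p.427] -/
theorem termLetters_of_walks {c : B13.Consts} (𝒦 : B13TermWalkData.TermKernels c d N' ν Nf E)
    [Fintype 𝒦.C₀] [DecidableEq 𝒦.C₀] (hX : 𝒦.X.Nonempty)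
    (L : (TPt d N' → ℂ) → E → Matrix 𝒦.Λ (𝒦.Λ ⊕ 𝒦.C₀) ℂ)
    (P : (TPt d N' → ℂ) → E → Matrix (𝒦.Λ ⊕ 𝒦.C₀) (𝒦.Λ ⊕ 𝒦.C₀) ℂ)
    (hG2 : ∀ σ u, 𝒦.G2 σ u = L σ u * invSqrt (P σ u))
    {R : ℝ} (hR : 0 < R)
    -- joint walk expansion of the local factor
    {εL kapL KbarL : ℝ} {WL : Type} {TL : WL → (TPt d N' → ℂ) → E → Matrix 𝒦.Λ (𝒦.Λ ⊕ 𝒦.C₀) ℂ} {SXL : Set WL}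
    {AL : WL → ℝ} {DL : WL → UT Nf → UT Nf → ℝ} {ρwL : ℝ}
    (hJL : JointWalkExpansion c 𝒦.locΛ 𝒦.locN L 𝒦.X R εL kapL KbarL TL SXL AL DL ρwL) (hεL : 0 ≤ εL) (hkapL : 0 ≤ kapL)
    -- joint walk expansion of the full precision, and its accretivity
    {εP kapP KbarP : ℝ} {WP : Type} {TP : WP → (TPt d N' → ℂ) → E → Matrix (𝒦.Λ ⊕ 𝒦.C₀) (𝒦.Λ ⊕ 𝒦.C₀) ℂ} {SXP : Set WP}
    {AP : WP → ℝ} {DP : WP → UT Nf → UT Nf → ℝ} {ρwP : ℝ}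
    (hJP : JointWalkExpansion c 𝒦.locN 𝒦.locN P 𝒦.X R εP kapP KbarP TP SXP AP DP ρwP) (hεP : 0 ≤ εP) (hkapP : 0 < kapP)
    {m : ℝ} (hm : 0 < m)
    (hPacc : ∀ σ : TPt d N' → ℂ, (∀ j, ‖σ j‖ ≤ Real.exp c.κ₁) → ∀ u ∈ ball (0 : E) R,
      ∀ v : 𝒦.Λ ⊕ 𝒦.C₀ → ℂ, m * ∑ i, ‖v i‖ ^ 2 ≤ (∑ i, star (v i) * (P σ u *ᵥ v) i).re)
    -- joint walk expansion of the term's precision, and its accretivity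
    {εA kapA KbarA : ℝ} {WA : Type} {TA : WA → (TPt d N' → ℂ) → E → Matrix 𝒦.Λ 𝒦.Λ ℂ} {SXA : Set WA}
    {AA : WA → ℝ} {DA : WA → UT Nf → UT Nf → ℝ} {ρwA : ℝ}
    (hJA : JointWalkExpansion c 𝒦.locΛ 𝒦.locΛ 𝒦.A2 𝒦.X R εA kapA KbarA TA SXA AA DA ρwA) (hεA : 0 ≤ εA) (hkapA : 0 ≤ kapA)
    {mA : ℝ} (hmA : 0 < mA)
    (hAacc : ∀ σ : TPt d N' → ℂ, (∀ j, ‖σ j‖ ≤ Real.exp c.κ₁) → ∀ u ∈ ball (0 : E) R,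
      ∀ v : 𝒦.Λ → ℂ, mA * ∑ i, ‖v i‖ ^ 2 ≤ (∑ i, star (v i) * (𝒦.A2 σ u *ᵥ v) i).re)
    -- volume sums at rate `η` and the geometric clause
    {η cV Rσ : ℝ} (hη : 0 ≤ η) (hcV : 0 ≤ cV)
    (hvolN : ∀ i : 𝒦.Λ ⊕ 𝒦.C₀, ∑ k : 𝒦.Λ ⊕ 𝒦.C₀, Real.exp (-(η * tdist1 Nf (𝒦.locN i) (𝒦.locN k))) ≤ cV)
    (hvolN' : ∀ j : 𝒦.Λ ⊕ 𝒦.C₀, ∑ l : 𝒦.Λ ⊕ 𝒦.C₀, Real.exp (-(η * tdist1 Nf (𝒦.locN l) (𝒦.locN j))) ≤ cV)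
    (hvolΛN : ∀ i : 𝒦.Λ, ∑ k : 𝒦.Λ ⊕ 𝒦.C₀, Real.exp (-(η * tdist1 Nf (𝒦.locΛ i) (𝒦.locN k))) ≤ cV)
    (hvolΛ : ∀ i : 𝒦.Λ, ∑ k : 𝒦.Λ, Real.exp (-(η * tdist1 Nf (𝒦.locΛ i) (𝒦.locΛ k))) ≤ cV)
    (hfar : ∀ b : 𝒦.Λ, ∀ z ∈ 𝒦.X, Rσ ≤ tdist1 Nf (𝒦.locΛ b) z)
    -- rate bookkeeping
    {κ θ' ρL ρE κC ρ₀ ρ' : ℝ}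
    (hκ : 0 ≤ κ) (hκ4 : κ ≤ kapP / 4) (hκm : 8 * KbarP * κ * cV ≤ m * kapP) (hηP : η ≤ kapP / 2)
    (hθ' : 0 ≤ θ') (hθ'ε : θ' ≤ εP) (hθ'η : θ' + η ≤ κ)
    (hρL : ρL ≤ kapL) (hρLε : ρL ≤ εL)
    (hρEpos : 0 < ρE) (hρEk : ρE ≤ kapA) (hρEε : ρE ≤ εA) (hηE : η ≤ ρE / 2)
    (hκC : 0 ≤ κC) (hκC4 : κC ≤ ρE / 4) (hκCm : 8 * KbarA * κC * cV ≤ mA * ρE)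
    (hρ' : 0 ≤ ρ') (hsplit : ρ' + η ≤ ρ₀) (hρ₀L : ρ₀ ≤ ρL) (hρ₀S : ρ₀ ≤ θ') (hρ'E : ρ' ≤ ρE) :
    TermLetters 𝒦 R ρ' κC (KbarL * (4 / Real.sqrt m) * cV)
      ((2 * KbarL * (4 / Real.sqrt m) + KbarL * (16 * (2 * KbarP) * cV ^ 2 / (m * Real.sqrt m))) * cV)
      KbarA (2 * KbarA) (4 / mA) Rσ := by
  -- letters of the local factor and of the term's precision from their expansions (§2)
  have hL : KernelLetters c 𝒦.locΛ 𝒦.locN L 𝒦.X R ρL KbarL (2 * KbarL) :=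
    kernelLetters_of_jointWalkExpansion hJL hX hR hεL hkapL hρL hρLε
  have hE : KernelLetters c 𝒦.locΛ 𝒦.locΛ 𝒦.A2 𝒦.X R ρE KbarA (2 * KbarA) :=
    kernelLetters_of_jointWalkExpansion hJA hX hR hεA hkapA hρEk hρEε
  -- the three precision-level letters of the square root's precision from its expansion (§2)
  obtain ⟨hPdec, hPloc, hPholo⟩ := precisionLetters_of_jointWalkExpansion hJP hX hR hεP hkapP.le
  have hKP : 0 ≤ KbarP := kbar_nonneg_of_jointWalkExpansion hJP hX
  -- §3
  exact termLetters_of_sqrtFactor_expDecay 𝒦 hX L P hG2 hR hη hρ' hsplit hρ₀L hρ₀S hρ'E hL hm hKP hkapP hκ hκ4 hκm hηP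
    (by positivity : (0 : ℝ) ≤ 2 * KbarP) hθ' hθ'ε hθ'η hPacc hPdec hPloc hPholo hE hρEpos hηE hmA hκC hκC4 hκCm hAacc
    hvolN hvolN' hvolΛN hvolΛ hcV hfar

/-! ## §5. Non-vacuity of the rate bookkeeping -/

/-- **The rate side conditions of §3∕§4 are jointly satisfiable with strictly positive output rates.**  Given the inputs' rates and
constants — `κ_P > 0` (decay rate of the full precision), `m > 0`, `K̄_P ≥ 0`; `κ_L, ε_L, κ_A⁰, ε_A, ε_P > 0`; `m_A > 0`, `K̄_A ≥ 0`;
and a volume constant `c_V ≥ 0` valid at every rate `η ≤ η₀` (`η₀ > 0`; on the unit-lattice torus any `η > 0` has one, uniformly in the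
volume) — there are rates `η, κ, θ′, ρ_L, ρ_E, κ_C, ρ₀, ρ′` meeting ALL the inequalities of `termLetters_of_walks`, with `η, ρ′, κ_C > 0`
(so the output letters decay at positive rates).  Elementary: take the Combes–Thomas rates of `NodeOLettersSqrtExpDecay.exists_uniform_rate`,
`ρ_E := min(κ_A⁰, ε_A)`, `μ := min(κ, ε_P, κ_L, ε_L, ρ_E)`, `η := min(η₀, μ/4, κ_P/2, ρ_E/2)`, `θ′ = ρ₀ := μ/2`, `ρ′ := μ/4`.
[cite: Balaban1988RG2Cluster, (2.16) p.16; Balaban1985BackgroundPropagators, Thm 3.10 p.416] -/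
theorem exists_rates {kapP m KbarP kapL εL kapA εA εP mA KbarA cV η₀ : ℝ}
    (hkapP : 0 < kapP) (hm : 0 < m) (hKP : 0 ≤ KbarP) (hkapL : 0 < kapL) (hεL : 0 < εL) (hkapA : 0 < kapA) (hεA : 0 < εA)
    (hεP : 0 < εP) (hmA : 0 < mA) (hKA : 0 ≤ KbarA) (hcV : 0 ≤ cV) (hη₀ : 0 < η₀) :
    ∃ η κ θ' ρL ρE κC ρ₀ ρ' : ℝ,
      0 < η ∧ η ≤ η₀ ∧ 0 < ρ' ∧ 0 < κC ∧
      0 ≤ κ ∧ κ ≤ kapP / 4 ∧ 8 * KbarP * κ * cV ≤ m * kapP ∧ η ≤ kapP / 2 ∧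
      0 ≤ θ' ∧ θ' ≤ εP ∧ θ' + η ≤ κ ∧
      ρL ≤ kapL ∧ ρL ≤ εL ∧
      0 < ρE ∧ ρE ≤ kapA ∧ ρE ≤ εA ∧ η ≤ ρE / 2 ∧
      0 ≤ κC ∧ κC ≤ ρE / 4 ∧ 8 * KbarA * κC * cV ≤ mA * ρE ∧
      0 ≤ ρ' ∧ ρ' + η ≤ ρ₀ ∧ ρ₀ ≤ ρL ∧ ρ₀ ≤ θ' ∧ ρ' ≤ ρE := by
  -- Combes–Thomas rate for `P`
  obtain ⟨κ, hκpos, hκ4, hκm⟩ :=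
    NodeOLettersSqrtExpDecay.exists_uniform_rate (m := m) (a := KbarP) (κ₀ := kapP) (cV := cV) hm hkapP hKP hcV
  -- the term precision's letter rate and its Combes–Thomas rate
  set ρE : ℝ := min kapA εA with hρEdef
  have hρEpos : 0 < ρE := lt_min hkapA hεA
  obtain ⟨κC, hκCpos, hκC4, hκCm⟩ :=
    NodeOLettersSqrtExpDecay.exists_uniform_rate (m := mA) (a := KbarA) (κ₀ := ρE) (cV := cV) hmA hρEpos hKA hcV
  -- the master rate
  set μ : ℝ := min (min (min (min κ εP) kapL) εL) ρE with hμdef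
  have hμpos : 0 < μ := lt_min (lt_min (lt_min (lt_min hκpos hεP) hkapL) hεL) hρEpos
  have hμκ : μ ≤ κ := le_trans (min_le_left _ _) (le_trans (min_le_left _ _) (le_trans (min_le_left _ _) (min_le_left _ _)))
  have hμεP : μ ≤ εP := le_trans (min_le_left _ _) (le_trans (min_le_left _ _) (le_trans (min_le_left _ _) (min_le_right _ _)))
  have hμkapL : μ ≤ kapL := le_trans (min_le_left _ _) (le_trans (min_le_left _ _) (min_le_right _ _))
  have hμεL : μ ≤ εL := le_trans (min_le_left _ _) (min_le_right _ _)
  have hμρE : μ ≤ ρE := min_le_right _ _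
  set η : ℝ := min (min (min η₀ (μ / 4)) (kapP / 2)) (ρE / 2) with hηdef
  have hηpos : 0 < η := lt_min (lt_min (lt_min hη₀ (by positivity)) (by positivity)) (by positivity)
  have hηη₀ : η ≤ η₀ := le_trans (min_le_left _ _) (le_trans (min_le_left _ _) (min_le_left _ _))
  have hημ : η ≤ μ / 4 := le_trans (min_le_left _ _) (le_trans (min_le_left _ _) (min_le_right _ _))
  have hηP : η ≤ kapP / 2 := le_trans (min_le_left _ _) (min_le_right _ _)
  have hηE : η ≤ ρE / 2 := min_le_right _ _
  refine ⟨η, κ, μ / 2, μ, ρE, κC, μ / 2, μ / 4, hηpos, hηη₀, by positivity, hκCpos, hκpos.le, hκ4, hκm, hηP,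
    by positivity, by linarith, by linarith, hμkapL, hμεL, hρEpos, min_le_left _ _, min_le_right _ _, hηE,
    hκCpos.le, hκC4, hκCm, by positivity, by linarith, by linarith, le_rfl, by linarith⟩

end Term

/-! ## §6. TWO-CONSTANT EDITIONS (v1.1): the Combes–Thomas volume constant at rate `κ_P∕2`, the letters' one at rate `η`

LOCATED SLOT GUARD (cell `ym-nodeO-ideate` P3 g24, memo `NodeO-walks-rung-P3g24.lean`, kernel-checked; pub-ymgap INBOX
2026-08-26T09:55:57Z): in §3∕§4 ONE volume constant `c_V` at ONE rate `η` serves both the square root's Combes–Thomas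
condition `8K̄_Pκc_V ≤ mκ_P` and the rate-`η` volume sums, while `θ′ + η ≤ κ` forces `2η ≤ κ`; for a family exhausting the
lattice this makes the bundle instantiable only when `κ_P·m∕K̄_P ≥ 16·min_η ηc_V(η)` — excluded for finite-difference
precisions whose nearest-neighbour entries are comparable to the diagonal.  The theorems are true; the repair is the
`c_V₀ ∕ c_V` split that `NodeOLettersSqrtExpDecay.kernelLetters_invSqrt_of_expDecay` already carries: a SEPARATE constant
`c_V₀` for the volume sums at rate `κ_P∕2` in the Combes–Thomas condition, `c_V` at rate `η` elsewhere, `η ≤ κ_P∕2` dropped.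
The §3∕§4 statements are the specialisation `c_V₀ := c_V` (by `volume_mono`, `η ≤ κ_P∕2`). -/

section TwoConstant

variable {d N' : ℕ} {ν : ℕ} {Nf : Fin ν → ℕ} [∀ i, NeZero (Nf i)]
variable {E : Type*} [NormedAddCommGroup E] [NormedSpace ℂ E]

/-- **`TermLetters` OF A «LOCAL FACTOR × SQUARE ROOT» TERM — TWO-CONSTANT EDITION of `termLetters_of_sqrtFactor_expDecay`**:
the Combes–Thomas smallness of the full precision reads `8aκc_V₀ ≤ mκ₀` with `c_V₀` a bound for the volume sums at rate
`κ₀∕2` (`hvol₀`), the four rate-`η` volume sums keep their own constant `c_V`; the hypothesis `η ≤ κ₀∕2` is gone.  Same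
output `TermLetters 𝒦 R ρ′ κ_A (B_L·(4/√m)·c_V) ((B_L′·(4/√m) + B_L·16B₀c_V²/(m√m))·c_V) B_E B_E′ (4/m_A) R_σ`.
[cite: Balaban1988RG2Cluster, (2.14)–(2.16) pp.15–16, (2.7) p.13; Balaban1985BackgroundPropagators, Thm 3.10 p.416] -/
theorem termLetters_of_sqrtFactor_expDecay₂ {c : B13.Consts} (𝒦 : B13TermWalkData.TermKernels c d N' ν Nf E)
    [Fintype 𝒦.C₀] [DecidableEq 𝒦.C₀] (hX : 𝒦.X.Nonempty)
    (L : (TPt d N' → ℂ) → E → Matrix 𝒦.Λ (𝒦.Λ ⊕ 𝒦.C₀) ℂ)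
    (P : (TPt d N' → ℂ) → E → Matrix (𝒦.Λ ⊕ 𝒦.C₀) (𝒦.Λ ⊕ 𝒦.C₀) ℂ)
    (hG2 : ∀ σ u, 𝒦.G2 σ u = L σ u * invSqrt (P σ u))
    {R ρL BL BL' m a κ₀ κ cV₀ B₀ ρ₀P θ' ρE BE BE' mA κA η cV ρ₀ ρ' Rσ : ℝ}
    (hR : 0 < R) (hη : 0 ≤ η) (hρ' : 0 ≤ ρ') (hsplit : ρ' + η ≤ ρ₀) (hρ₀L : ρ₀ ≤ ρL) (hρ₀S : ρ₀ ≤ θ') (hρE : ρ' ≤ ρE)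
    -- letters of the local factor
    (hL : KernelLetters c 𝒦.locΛ 𝒦.locN L 𝒦.X R ρL BL BL')
    -- the full precision `P`: accretivity, exponential-decay letter, Combes–Thomas volume constant at rate `κ₀/2`,
    -- σ-localisation, holomorphy; Combes–Thomas rate `κ`
    (hm : 0 < m) (ha : 0 ≤ a) (hκ₀ : 0 < κ₀) (hκ : 0 ≤ κ) (hκ4 : κ ≤ κ₀ / 4) (hκm : 8 * a * κ * cV₀ ≤ m * κ₀)
    (hB₀ : 0 ≤ B₀) (hθ' : 0 ≤ θ') (hθ'ρ : θ' ≤ ρ₀P) (hθ'η : θ' + η ≤ κ)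
    (hPacc : ∀ σ : TPt d N' → ℂ, (∀ j, ‖σ j‖ ≤ Real.exp c.κ₁) → ∀ u ∈ ball (0 : E) R,
      ∀ v : 𝒦.Λ ⊕ 𝒦.C₀ → ℂ, m * ∑ i, ‖v i‖ ^ 2 ≤ (∑ i, star (v i) * (P σ u *ᵥ v) i).re)
    (hPdec : ∀ σ : TPt d N' → ℂ, (∀ j, ‖σ j‖ ≤ Real.exp c.κ₁) → ∀ u ∈ ball (0 : E) R,
      ∀ i l, ‖P σ u i l‖ ≤ a * Real.exp (-(κ₀ * tdist1 Nf (𝒦.locN i) (𝒦.locN l))))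
    (hvol₀ : ∀ i : 𝒦.Λ ⊕ 𝒦.C₀, ∑ l : 𝒦.Λ ⊕ 𝒦.C₀,
      Real.exp (-(κ₀ / 2 * tdist1 Nf (𝒦.locN i) (𝒦.locN l))) ≤ cV₀)
    (hPloc : ∀ σ : TPt d N' → ℂ, (∀ j, ‖σ j‖ ≤ Real.exp c.κ₁) →
      ∀ k l, ‖(P σ 0 - P 0 0) k l‖ ≤ B₀ * Real.exp (-(ρ₀P * distX 𝒦.X (𝒦.locN k) (𝒦.locN l))))
    (hPholo : ∀ σ : TPt d N' → ℂ, (∀ j, ‖σ j‖ ≤ Real.exp c.κ₁) →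
      ∀ i j, DifferentiableOn ℂ (fun u => P σ u i j) (ball (0 : E) R))
    -- the term's precision `𝒦.A2`: letters + accretivity; Combes–Thomas rate `κ_A`
    (hE : KernelLetters c 𝒦.locΛ 𝒦.locΛ 𝒦.A2 𝒦.X R ρE BE BE') (hρEpos : 0 < ρE) (hηρE : η ≤ ρE / 2)
    (hmA : 0 < mA) (hκA : 0 ≤ κA) (hκA4 : κA ≤ ρE / 4) (hκAm : 8 * BE * κA * cV ≤ mA * ρE)
    (hAacc : ∀ σ : TPt d N' → ℂ, (∀ j, ‖σ j‖ ≤ Real.exp c.κ₁) → ∀ u ∈ ball (0 : E) R,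
      ∀ v : 𝒦.Λ → ℂ, mA * ∑ i, ‖v i‖ ^ 2 ≤ (∑ i, star (v i) * (𝒦.A2 σ u *ᵥ v) i).re)
    -- volume sums at rate `η`
    (hvolN : ∀ i : 𝒦.Λ ⊕ 𝒦.C₀, ∑ k : 𝒦.Λ ⊕ 𝒦.C₀, Real.exp (-(η * tdist1 Nf (𝒦.locN i) (𝒦.locN k))) ≤ cV)
    (hvolN' : ∀ j : 𝒦.Λ ⊕ 𝒦.C₀, ∑ l : 𝒦.Λ ⊕ 𝒦.C₀, Real.exp (-(η * tdist1 Nf (𝒦.locN l) (𝒦.locN j))) ≤ cV)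
    (hvolΛN : ∀ i : 𝒦.Λ, ∑ k : 𝒦.Λ ⊕ 𝒦.C₀, Real.exp (-(η * tdist1 Nf (𝒦.locΛ i) (𝒦.locN k))) ≤ cV)
    (hvolΛ : ∀ i : 𝒦.Λ, ∑ k : 𝒦.Λ, Real.exp (-(η * tdist1 Nf (𝒦.locΛ i) (𝒦.locΛ k))) ≤ cV) (hcV : 0 ≤ cV)
    -- geometry
    (hfar : ∀ b : 𝒦.Λ, ∀ z ∈ 𝒦.X, Rσ ≤ tdist1 Nf (𝒦.locΛ b) z) :
    TermLetters 𝒦 R ρ' κA (BL * (4 / Real.sqrt m) * cV)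
      ((BL' * (4 / Real.sqrt m) + BL * (16 * B₀ * cV ^ 2 / (m * Real.sqrt m))) * cV) BE BE' (4 / mA) Rσ := by
  -- the square-root factor's letters, on the columns' locations (exp-decay edition, `cV₀` at rate `κ₀/2`)
  have hS : KernelLetters c 𝒦.locN 𝒦.locN (fun σ u => invSqrt (P σ u)) 𝒦.X R θ' (4 / Real.sqrt m)
      (16 * B₀ * cV ^ 2 / (m * Real.sqrt m)) :=
    kernelLetters_invSqrt_of_expDecay c 𝒦.locN hX P hR hm ha hκ₀ hκ hκ4 hκm hη hB₀ hθ' hθ'ρ hθ'η hPacc hPdec hvol₀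
      hPloc hPholo hvolN hvolN'
  -- both factors at the common rate `ρ₀`, then the product at rate `ρ'`
  have hL₀ := kernelLetters_mono_rate c hρ₀L hL
  have hS₀ := kernelLetters_mono_rate c hρ₀S hS
  have hprod := kernelLetters_mul c hX hR hρ' hη hsplit hcV hL₀ hS₀ hvolΛN hvolN'
  have hG : 𝒦.G2 = fun σ u => L σ u * invSqrt (P σ u) := funext fun σ => funext fun u => hG2 σ u
  have hΓ : KernelLetters c 𝒦.locΛ 𝒦.locN 𝒦.G2 𝒦.X R ρ' (BL * (4 / Real.sqrt m) * cV)
      ((BL' * (4 / Real.sqrt m) + BL * (16 * B₀ * cV ^ 2 / (m * Real.sqrt m))) * cV) := by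
    rw [hG]; exact hprod
  -- the covariance letter: `A2`'s decay letter ⟹ weighted sums `≤ m_A/2` at rate `κ_A` ⟹ almost-local Combes–Thomas
  have hBE : 0 ≤ BE := hE.B_nonneg
  set dd : 𝒦.Λ → 𝒦.Λ → ℝ := fun i l => tdist1 Nf (𝒦.locΛ i) (𝒦.locΛ l) with hdd
  have hdnn : ∀ i l, 0 ≤ dd i l := fun i l => tdist1_nonneg _ _
  have hvolA : ∀ i : 𝒦.Λ, ∑ l : 𝒦.Λ, Real.exp (-(ρE / 2 * dd i l)) ≤ cV :=
    fun i => volume_mono (fun l => 𝒦.locΛ l) (𝒦.locΛ i) hηρE (hvolΛ i)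
  have hvolA' : ∀ l : 𝒦.Λ, ∑ i : 𝒦.Λ, Real.exp (-(ρE / 2 * dd i l)) ≤ cV := by
    intro l
    have e : ∀ i, dd i l = dd l i := fun i => tdist1_comm _ _
    simpa [e] using hvolA l
  have hC : ∀ σ : TPt d N' → ℂ, (∀ j, ‖σ j‖ ≤ Real.exp c.κ₁) → ∀ u ∈ ball (0 : E) R,
      ∀ i j, ‖(𝒦.A2 σ u)⁻¹ i j‖ ≤ 4 / mA * Real.exp (-(κA * tdist1 Nf (𝒦.locΛ i) (𝒦.locΛ j))) := by
    intro σ hσ u hu i j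
    have hW := weightedSums_le_half_of_expDecay dd hdnn (𝒦.A2 σ u) hBE hρEpos hκA hκA4 hκAm
      (fun i l => hE.decay σ hσ u hu i l) hvolA hvolA'
    exact (B13Sqrt27AccretiveAlmostLocal.almostLocal_inverse_decay dd (fun a => tdist1_self _) (fun a b => tdist1_comm _ _)
      (fun a b e => tdist1_triangle _ _ _) (𝒦.A2 σ u) hmA hκA (by positivity : (0 : ℝ) ≤ mA / 2) le_rfl (hAacc σ hσ u hu)
      hW.1 hW.2).2 i j
  exact ⟨hX, hΓ, kernelLetters_mono_rate c hρE hE, hC, by positivity, hfar⟩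

/-- **THE CAPSTONE, TWO-CONSTANT EDITION of `termLetters_of_walks`** (the form a witness ∕ a uniform package should
target): `TermLetters` of a «local factor × square root» term from three joint walk expansions + two accretivity constants +
the (2.7) reading + volume sums, with the Combes–Thomas condition of the full precision on its OWN volume constant `c_V₀` at
rate `κ_P∕2` (`hvolN₀`, `hκm : 8K̄_Pκc_V₀ ≤ mκ_P`) and the four rate-`η` volume sums on `c_V`; `η ≤ κ_P∕2` dropped, every
other hypothesis and the output verbatim as in `termLetters_of_walks`.  NON-CIRCULAR order of choices for a package:
`(κ_P, m, K̄_P)` ⟹ `c_V₀ := V(κ_P∕2)` ⟹ `κ` ⟹ `θ′, η ≤ κ` ⟹ `c_V := V(η)` ⟹ `κ_C` — now the tree declaration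
`NodeOLettersOfWalksAcross.WalkPackage.stdRates` (downstream leaf `NodeOLettersOfWalksAcross`, p443891: the rate book as DATA, `etaMax`
reading neither `η` nor `c_V`; originally the memo cell ym-nodeO P3 g24's sketch `NodeO-walks-rung-P3g24.lean`); §5 `exists_rates` is
this file's own non-circularity statement. [cite: Balaban1988RG2Cluster, (2.7) p.13, p.15, (2.14)–(2.16) pp.15–16; Balaban1985BackgroundPropagators, Thm 3.10 p.416, (3.154) p.427] -/
theorem termLetters_of_walks₂ {c : B13.Consts} (𝒦 : B13TermWalkData.TermKernels c d N' ν Nf E)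
    [Fintype 𝒦.C₀] [DecidableEq 𝒦.C₀] (hX : 𝒦.X.Nonempty)
    (L : (TPt d N' → ℂ) → E → Matrix 𝒦.Λ (𝒦.Λ ⊕ 𝒦.C₀) ℂ)
    (P : (TPt d N' → ℂ) → E → Matrix (𝒦.Λ ⊕ 𝒦.C₀) (𝒦.Λ ⊕ 𝒦.C₀) ℂ)
    (hG2 : ∀ σ u, 𝒦.G2 σ u = L σ u * invSqrt (P σ u))
    {R : ℝ} (hR : 0 < R)
    -- joint walk expansion of the local factor
    {εL kapL KbarL : ℝ} {WL : Type} {TL : WL → (TPt d N' → ℂ) → E → Matrix 𝒦.Λ (𝒦.Λ ⊕ 𝒦.C₀) ℂ} {SXL : Set WL}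
    {AL : WL → ℝ} {DL : WL → UT Nf → UT Nf → ℝ} {ρwL : ℝ}
    (hJL : JointWalkExpansion c 𝒦.locΛ 𝒦.locN L 𝒦.X R εL kapL KbarL TL SXL AL DL ρwL) (hεL : 0 ≤ εL) (hkapL : 0 ≤ kapL)
    -- joint walk expansion of the full precision, and its accretivity
    {εP kapP KbarP : ℝ} {WP : Type} {TP : WP → (TPt d N' → ℂ) → E → Matrix (𝒦.Λ ⊕ 𝒦.C₀) (𝒦.Λ ⊕ 𝒦.C₀) ℂ} {SXP : Set WP}
    {AP : WP → ℝ} {DP : WP → UT Nf → UT Nf → ℝ} {ρwP : ℝ}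
    (hJP : JointWalkExpansion c 𝒦.locN 𝒦.locN P 𝒦.X R εP kapP KbarP TP SXP AP DP ρwP) (hεP : 0 ≤ εP) (hkapP : 0 < kapP)
    {m : ℝ} (hm : 0 < m)
    (hPacc : ∀ σ : TPt d N' → ℂ, (∀ j, ‖σ j‖ ≤ Real.exp c.κ₁) → ∀ u ∈ ball (0 : E) R,
      ∀ v : 𝒦.Λ ⊕ 𝒦.C₀ → ℂ, m * ∑ i, ‖v i‖ ^ 2 ≤ (∑ i, star (v i) * (P σ u *ᵥ v) i).re)
    -- joint walk expansion of the term's precision, and its accretivity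
    {εA kapA KbarA : ℝ} {WA : Type} {TA : WA → (TPt d N' → ℂ) → E → Matrix 𝒦.Λ 𝒦.Λ ℂ} {SXA : Set WA}
    {AA : WA → ℝ} {DA : WA → UT Nf → UT Nf → ℝ} {ρwA : ℝ}
    (hJA : JointWalkExpansion c 𝒦.locΛ 𝒦.locΛ 𝒦.A2 𝒦.X R εA kapA KbarA TA SXA AA DA ρwA) (hεA : 0 ≤ εA) (hkapA : 0 ≤ kapA)
    {mA : ℝ} (hmA : 0 < mA)
    (hAacc : ∀ σ : TPt d N' → ℂ, (∀ j, ‖σ j‖ ≤ Real.exp c.κ₁) → ∀ u ∈ ball (0 : E) R,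
      ∀ v : 𝒦.Λ → ℂ, mA * ∑ i, ‖v i‖ ^ 2 ≤ (∑ i, star (v i) * (𝒦.A2 σ u *ᵥ v) i).re)
    -- the Combes–Thomas volume constant `c_V₀` at rate `κ_P/2`; volume sums at rate `η`; the geometric clause
    {cV₀ η cV Rσ : ℝ}
    (hvolN₀ : ∀ i : 𝒦.Λ ⊕ 𝒦.C₀, ∑ k : 𝒦.Λ ⊕ 𝒦.C₀,
      Real.exp (-(kapP / 2 * tdist1 Nf (𝒦.locN i) (𝒦.locN k))) ≤ cV₀)
    (hη : 0 ≤ η) (hcV : 0 ≤ cV)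
    (hvolN : ∀ i : 𝒦.Λ ⊕ 𝒦.C₀, ∑ k : 𝒦.Λ ⊕ 𝒦.C₀, Real.exp (-(η * tdist1 Nf (𝒦.locN i) (𝒦.locN k))) ≤ cV)
    (hvolN' : ∀ j : 𝒦.Λ ⊕ 𝒦.C₀, ∑ l : 𝒦.Λ ⊕ 𝒦.C₀, Real.exp (-(η * tdist1 Nf (𝒦.locN l) (𝒦.locN j))) ≤ cV)
    (hvolΛN : ∀ i : 𝒦.Λ, ∑ k : 𝒦.Λ ⊕ 𝒦.C₀, Real.exp (-(η * tdist1 Nf (𝒦.locΛ i) (𝒦.locN k))) ≤ cV)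
    (hvolΛ : ∀ i : 𝒦.Λ, ∑ k : 𝒦.Λ, Real.exp (-(η * tdist1 Nf (𝒦.locΛ i) (𝒦.locΛ k))) ≤ cV)
    (hfar : ∀ b : 𝒦.Λ, ∀ z ∈ 𝒦.X, Rσ ≤ tdist1 Nf (𝒦.locΛ b) z)
    -- rate bookkeeping (no `η ≤ κ_P/2`)
    {κ θ' ρL ρE κC ρ₀ ρ' : ℝ}
    (hκ : 0 ≤ κ) (hκ4 : κ ≤ kapP / 4) (hκm : 8 * KbarP * κ * cV₀ ≤ m * kapP)
    (hθ' : 0 ≤ θ') (hθ'ε : θ' ≤ εP) (hθ'η : θ' + η ≤ κ)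
    (hρL : ρL ≤ kapL) (hρLε : ρL ≤ εL)
    (hρEpos : 0 < ρE) (hρEk : ρE ≤ kapA) (hρEε : ρE ≤ εA) (hηE : η ≤ ρE / 2)
    (hκC : 0 ≤ κC) (hκC4 : κC ≤ ρE / 4) (hκCm : 8 * KbarA * κC * cV ≤ mA * ρE)
    (hρ' : 0 ≤ ρ') (hsplit : ρ' + η ≤ ρ₀) (hρ₀L : ρ₀ ≤ ρL) (hρ₀S : ρ₀ ≤ θ') (hρ'E : ρ' ≤ ρE) :
    TermLetters 𝒦 R ρ' κC (KbarL * (4 / Real.sqrt m) * cV)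
      ((2 * KbarL * (4 / Real.sqrt m) + KbarL * (16 * (2 * KbarP) * cV ^ 2 / (m * Real.sqrt m))) * cV)
      KbarA (2 * KbarA) (4 / mA) Rσ := by
  -- letters of the local factor and of the term's precision from their expansions (§2)
  have hL : KernelLetters c 𝒦.locΛ 𝒦.locN L 𝒦.X R ρL KbarL (2 * KbarL) :=
    kernelLetters_of_jointWalkExpansion hJL hX hR hεL hkapL hρL hρLε
  have hE : KernelLetters c 𝒦.locΛ 𝒦.locΛ 𝒦.A2 𝒦.X R ρE KbarA (2 * KbarA) :=
    kernelLetters_of_jointWalkExpansion hJA hX hR hεA hkapA hρEk hρEε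
  -- the three precision-level letters of the square root's precision from its expansion (§2)
  obtain ⟨hPdec, hPloc, hPholo⟩ := precisionLetters_of_jointWalkExpansion hJP hX hR hεP hkapP.le
  have hKP : 0 ≤ KbarP := kbar_nonneg_of_jointWalkExpansion hJP hX
  -- the two-constant §3
  exact termLetters_of_sqrtFactor_expDecay₂ 𝒦 hX L P hG2 hR hη hρ' hsplit hρ₀L hρ₀S hρ'E hL hm hKP hkapP hκ hκ4 hκm
    (by positivity : (0 : ℝ) ≤ 2 * KbarP) hθ' hθ'ε hθ'η hPacc hPdec hvolN₀ hPloc hPholo hE hρEpos hηE hmA hκC hκC4 hκCm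
    hAacc hvolN hvolN' hvolΛN hvolΛ hcV hfar

end TwoConstant

end Literature.MathematicalPhysics.QuantumFieldTheory.Balaban1983to89.NodeOLettersOfWalks

end
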